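import Mathlib
import HarnessLib
import Summits.Ventures.LatticeQCDFlow.Scaling.WilsonIdentityFlowLaw2D
import Summits.Ventures.LatticeQCDFlow.Scaling.IMHHoldingTimeESS

/-!
# LatticeQCDFlow / Scaling — the equilibrium HOLDING TIME of the untrained Wilson sampler for any
# compact gauge group: `E_π[1/a] ∈ [Z(2β)/Z(β)², 2·Z(2β)/Z(β)²] = [1/ESS, 2/ESS]`; on the SU(2) torus
# `1/ESS = (β/2)^{L²}·Σ_{n≥1} I_n(4β)^{L²}/(Σ_{n≥1} I_n(2β)^{L²})²`

HONEST FRAMING: exact (Metropolis-corrected) sampling algorithms for lattice gauge theory;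
figures of merit are autocorrelation/cost numbers at stated couplings and volumes; no
continuum-physics claim.

Venture `LatticeQCDFlow` (cell pub-lqcd), topic `Scaling`; FANOUT row 3 (`s0-u1-a`, S0-B
implementation A, GEN-13).  NEW WORK of the cell (closed forms, no numerics): row 2's general-space
holding-time law (`Scaling/IMHHoldingTimeESS`, imported: `∫ w/(1 − λ(w/q)) dμ ∈ [W₂/Z, 2W₂/Z]`,
`λ = rejCurve`) for the sampler of row 3's `Scaling/WilsonIdentityFlowLaw` (imported through
`WilsonIdentityFlowLaw2D`): configurations proposed i.i.d. from a reference probability law `μ` on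
`GaugeConfig d L G` (`q ≡ 1`) against the Boltzmann tilt `w = e^{−βS}` (`W₂ = ∫ w² dμ = Z_μ(2β)`,
`Z = Z_μ(β)`), for every compact `G`, continuous `ρ`, `d`, `L`, `β`:

* **`wilsonIdentityFlow_holdingIntegral_mem_Icc`** — `∫ w/(1 − λ(w)) dμ ∈ [Z(2β)/Z(β), 2Z(2β)/Z(β)]`;
* **`wilsonIdentityFlow_holdingTime_mem_Icc`** — the equilibrium mean holding time
  `E_π[1/a] = (1/Z(β)) ∫ w/(1 − λ(w)) dμ ∈ [Z(2β)/Z(β)², 2·Z(2β)/Z(β)²]`, i.e. `[1/ESS, 2/ESS]` with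
  row 3's `ESS = Z(β)²/Z(2β)`;
* **`su2TorusIdentityFlow_holdingTime_mem_Icc`** — on the SU(2) torus `(ℤ/L)²`, `β > 0`:
  `E_π[1/a] ∈ [h, 2h]`, `h = (β/2)^{L²}·Σ_n I_{n+1}(4β)^{L²}/(Σ_n I_{n+1}(2β)^{L²})²` (row 5's exact `Z`).

Reading (value-free; no number of ours is computed or implied): started in equilibrium, the untrained
exact sampler of ANY Wilson lattice gauge theory waits on average between `Z(2β)/Z(β)²` and twice that
many whole-lattice Haar proposals before it moves.  NOT CLAIMED: any value at the cell's `(β, L)`;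
nothing re-scored, SEALED.md untouched.
-/

noncomputable section

namespace Summit.Ventures.LatticeQCDFlow.Theory2

open MeasureTheory Real
open Literature.Analysis.FunctionSpaces (besselI)
open Literature.MathematicalPhysics.QuantumFieldTheory
open Literature.MathematicalPhysics.QuantumLattice (fundamentalRep continuous_fundamentalRep)
open Summit.Ventures.LatticeQCDFlow.Exactness (rejCurve)
open Summit.Ventures.LatticeQCDFlow.Scoring (partitionFunction_su2_two_toReal_eq_mul_tsum)

variable {d L N : ℕ} [NeZero L] {G : Type*} [Group G] [TopologicalSpace G] [IsTopologicalGroup G]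
  [CompactSpace G] [MeasurableSpace G] [BorelSpace G] (ρ : G →* Matrix (Fin N) (Fin N) ℂ)
  (μ : Measure (GaugeConfig d L G)) [IsProbabilityMeasure μ]

/-! ## §1 Any compact gauge group and reference law -/

/-- **ROW 2's HOLDING-TIME LAW FOR THE UNTRAINED WILSON SAMPLER (unnormalised form)**:
`∫ w/(1 − λ(w)) dμ ∈ [Z(2β)/Z(β), 2·Z(2β)/Z(β)]` with `w = e^{−βS}`, `q ≡ 1`. [ours] -/
theorem wilsonIdentityFlow_holdingIntegral_mem_Icc (hρ : Continuous ρ) (β : ℝ) :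
    ∫ U, Real.exp (-β * wilsonAction ρ U)
        / (1 - rejCurve μ (fun V => Real.exp (-β * wilsonAction ρ V)) (fun _ => (1 : ℝ))
            (Real.exp (-β * wilsonAction ρ U) / 1)) ∂μ
      ∈ Set.Icc ((∫ U, Real.exp (-(2 * β) * wilsonAction ρ U) ∂μ)
            / ∫ V, Real.exp (-β * wilsonAction ρ V) ∂μ)
          (2 * (∫ U, Real.exp (-(2 * β) * wilsonAction ρ U) ∂μ)
            / ∫ V, Real.exp (-β * wilsonAction ρ V) ∂μ) := by
  have hw0 : ∀ U : GaugeConfig d L G, 0 < Real.exp (-β * wilsonAction ρ U) := fun U => Real.exp_pos _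
  have hwm : Measurable fun U : GaugeConfig d L G => Real.exp (-β * wilsonAction ρ U) :=
    Real.measurable_exp.comp ((WilsonRP.measurable_wilsonAction ρ hρ).const_mul _)
  have hwi : Integrable (fun U : GaugeConfig d L G => Real.exp (-β * wilsonAction ρ U)) μ :=
    integrable_exp_mul_wilsonAction ρ hρ (-β) _
  have hq1 : ∫ _U, (1 : ℝ) ∂μ = 1 := by rw [integral_const, probReal_univ, one_smul]
  have hW₂ : Integrable (fun U : GaugeConfig d L G =>
      Real.exp (-β * wilsonAction ρ U) / 1 * Real.exp (-β * wilsonAction ρ U)) μ := by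
    simp_rw [div_one, ← sq, exp_neg_mul_wilsonAction_sq]
    exact integrable_exp_mul_wilsonAction ρ hρ _ _
  have hW₂val : ∫ U, Real.exp (-β * wilsonAction ρ U) / 1 * Real.exp (-β * wilsonAction ρ U) ∂μ
      = ∫ U, Real.exp (-(2 * β) * wilsonAction ρ U) ∂μ := by
    simp_rw [div_one, ← sq, exp_neg_mul_wilsonAction_sq]
  have h := holdingTime_mem_Icc (μ := μ) hw0 hwm hwi (fun _ => one_pos) measurable_const
    (integrable_const _) hq1 hW₂
  rw [hW₂val] at h
  exact h

/-- **THE EQUILIBRIUM MEAN HOLDING TIME `E_π[1/a] ∈ [Z(2β)/Z(β)², 2·Z(2β)/Z(β)²] = [1/ESS, 2/ESS]`**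
for the untrained sampler of every Wilson lattice gauge theory (any compact `G`, continuous `ρ`, `d`,
`L`, `β`, reference probability law `μ`). [ours] -/
theorem wilsonIdentityFlow_holdingTime_mem_Icc (hρ : Continuous ρ) (β : ℝ) :
    (∫ U, Real.exp (-β * wilsonAction ρ U)
        / (1 - rejCurve μ (fun V => Real.exp (-β * wilsonAction ρ V)) (fun _ => (1 : ℝ))
            (Real.exp (-β * wilsonAction ρ U) / 1)) ∂μ)
        / ∫ V, Real.exp (-β * wilsonAction ρ V) ∂μ
      ∈ Set.Icc ((∫ U, Real.exp (-(2 * β) * wilsonAction ρ U) ∂μ)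
            / (∫ V, Real.exp (-β * wilsonAction ρ V) ∂μ) ^ 2)
          (2 * (∫ U, Real.exp (-(2 * β) * wilsonAction ρ U) ∂μ)
            / (∫ V, Real.exp (-β * wilsonAction ρ V) ∂μ) ^ 2) := by
  have hZ := wilsonZI_pos ρ μ hρ β
  obtain ⟨h1, h2⟩ := wilsonIdentityFlow_holdingIntegral_mem_Icc ρ μ hρ β
  constructor
  · rw [sq, ← div_div]
    exact div_le_div_of_nonneg_right h1 hZ.le
  · rw [sq, ← div_div]
    exact div_le_div_of_nonneg_right h2 hZ.le

/-- The same with `Z = (partitionFunction ρ ·).toReal` for the product Haar reference law. [ours] -/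
theorem wilsonIdentityFlow_holdingTime_mem_Icc_partitionFunction (hρ : Continuous ρ) (β : ℝ) :
    (∫ U, Real.exp (-β * wilsonAction ρ U)
        / (1 - rejCurve (Measure.pi fun _ : Edge d L => haarProbability G)
            (fun V => Real.exp (-β * wilsonAction ρ V)) (fun _ => (1 : ℝ))
            (Real.exp (-β * wilsonAction ρ U) / 1))
          ∂(Measure.pi fun _ : Edge d L => haarProbability G))
        / ∫ V, Real.exp (-β * wilsonAction ρ V) ∂(Measure.pi fun _ : Edge d L => haarProbability G)
      ∈ Set.Icc ((partitionFunction (d := d) (L := L) ρ (2 * β)).toReal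
            / (partitionFunction (d := d) (L := L) ρ β).toReal ^ 2)
          (2 * (partitionFunction (d := d) (L := L) ρ (2 * β)).toReal
            / (partitionFunction (d := d) (L := L) ρ β).toReal ^ 2) := by
  rw [partitionFunction_toReal_eq_integral ρ hρ, partitionFunction_toReal_eq_integral ρ hρ]
  exact wilsonIdentityFlow_holdingTime_mem_Icc ρ _ hρ β

/-! ## §2 The SU(2) torus -/

/-- Prefactor algebra: `((e^{−4γ}/(2γ))^V B)/((e^{−2γ}/γ)^V A)² = (γ/2)^V · B/A²`. [folklore] -/
theorem su2_prefactor_cancel_inv {γ : ℝ} (hγ : γ ≠ 0) (V : ℕ) (A B : ℝ) :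
    ((Real.exp (-(2 * (2 * γ))) / (2 * γ)) ^ V * B) / ((Real.exp (-(2 * γ)) / γ) ^ V * A) ^ 2
      = (γ / 2) ^ V * (B / A ^ 2) := by
  by_cases hA : A = 0
  · simp [hA]
  by_cases hB : B = 0
  · simp [hB]
  have h := su2_prefactor_cancel hγ V A B
  have hL : ((Real.exp (-(2 * γ)) / γ) ^ V * A) ^ 2 / ((Real.exp (-(2 * (2 * γ))) / (2 * γ)) ^ V * B)
      ≠ 0 := by rw [h]; positivity
  rw [← inv_div, h, mul_inv, ← inv_pow, inv_div, inv_div]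

/-- **HOLDING TIME OF THE UNTRAINED SU(2) TORUS SAMPLER** (`β > 0`): `E_π[1/a] ∈ [h, 2h]` with
`h = (β/2)^{L²}·Σ_n I_{n+1}(4β)^{L²}/(Σ_n I_{n+1}(2β)^{L²})² = 1/ESS` (`4β` written `2·(2β)`). [ours] -/
theorem su2TorusIdentityFlow_holdingTime_mem_Icc {L : ℕ} [NeZero L] {β : ℝ} (hβ : 0 < β) :
    (∫ U, Real.exp (-β * wilsonAction (fundamentalRep (Fin 2)) U)
        / (1 - rejCurve
            (Measure.pi fun _ : Edge 2 L => haarProbability (Matrix.specialUnitaryGroup (Fin 2) ℂ))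
            (fun V => Real.exp (-β * wilsonAction (fundamentalRep (Fin 2)) V)) (fun _ => (1 : ℝ))
            (Real.exp (-β * wilsonAction (fundamentalRep (Fin 2)) U) / 1))
          ∂(Measure.pi fun _ : Edge 2 L => haarProbability (Matrix.specialUnitaryGroup (Fin 2) ℂ)))
        / ∫ V, Real.exp (-β * wilsonAction (fundamentalRep (Fin 2)) V)
          ∂(Measure.pi fun _ : Edge 2 L => haarProbability (Matrix.specialUnitaryGroup (Fin 2) ℂ))
      ∈ Set.Icc ((β / 2) ^ (L ^ 2) * ((∑' n : ℕ, besselI (n + 1) (2 * (2 * β)) ^ (L ^ 2))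
            / (∑' n : ℕ, besselI (n + 1) (2 * β) ^ (L ^ 2)) ^ 2))
          (2 * ((β / 2) ^ (L ^ 2) * ((∑' n : ℕ, besselI (n + 1) (2 * (2 * β)) ^ (L ^ 2))
            / (∑' n : ℕ, besselI (n + 1) (2 * β) ^ (L ^ 2)) ^ 2))) := by
  have h := wilsonIdentityFlow_holdingTime_mem_Icc_partitionFunction (d := 2) (L := L)
    (fundamentalRep (Fin 2)) (continuous_fundamentalRep (Fin 2)) β
  rw [partitionFunction_su2_two_toReal_eq_mul_tsum hβ,
    partitionFunction_su2_two_toReal_eq_mul_tsum (by linarith : 0 < 2 * β)] at h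
  obtain ⟨h1, h2⟩ := h
  rw [su2_prefactor_cancel_inv hβ.ne'] at h1
  rw [mul_div_assoc, su2_prefactor_cancel_inv hβ.ne'] at h2
  exact ⟨h1, h2⟩

end Summit.Ventures.LatticeQCDFlow.Theory2

end
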